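import Literature.Topology.FourManifolds.WallHandlebodyBoundaryProofs
import Literature.AlgebraicTopology.SingularHomology.UniversalCoefficientsFree
import HarnessLib

/-!
# Wall 1964, §2: `H₂(∂V) → H₂(V)` is onto for a handlebody `V ∈ ℋ(5, k, 2)` — proved

Topic `Literature/Topology/FourManifolds`; sibling of `WallHandlebodyBoundaryProofs.lean`, in the
cone of the named fact `Literature.Topology.FourManifolds.isHCobordant_of_equivalent_intersectionForm`
(**Wall 1964, Thm. 2**; C. T. C. Wall, *On simply-connected 4-manifolds*, J. London Math. Soc.
39 (1964) 141–149; `HCobordismDonaldson.lean`). In the proof of Thm. 2 (p. 146) Wall attaches the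
handlebody `V` (Smale's `ℋ(5, k, 2)`: one `0`-handle, `k` `2`-handles; Lemma 2 and [10]) to the
h-cobordism along `∂V` and uses "If we attach `V`, the kernel of `H₂(∂V) → H₂(V)` is `L`" together
with the fact — implicit in "`L` … with rank equal to … half that of `H₂(∂V)`" (p. 144) and in the
computation of `H₂(R)` — that **every class of `H₂(V)` comes from `∂V`**, i.e. `H₂(∂V) → H₂(V)`
is onto (equivalently `H₂(V, ∂V) ≅ H³(V) = 0`). This is the hypothesis
`Epi (H₂(∂W) → H₂(W))` of the tree's Mayer–Vietoris workhorse
`CobordismAttachment.epi_map_jX_of_epi` (`CobordismAttachmentHomology.lean`) for the attachment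
`R₀ = V ∪ C`, and this file PROVES it from the handle structure:

* `Cobordism.IsNiceMorseFunction.isZero_three` — along Milnor's filtration of a nice Morse
  function without critical points of index `3`, `H₃(W_m, V) = 0` (Milnor 1965, Cor. 3.15 and
  the exact sequences of the triples, as in `isZero_four_and_isTorsionFree_two`);
* `isZero_singularHomology_three_of_hasHandleDecomposition` — `H₃(V; ℤ) = 0` for
  `V ∈ ℋ(5, k, 2)`; with `WallHandlebodyBoundaryProofs` (`H₂(V; ℤ)` finitely generated and
  torsion-free) `H₂(V; ℤ)` is free (`free_singularHomology_two_of_hasHandleDecomposition`) and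
  `H³(V; ℤ) ≅ Hom(H₃(V; ℤ), ℤ) = 0` by universal coefficients
  (`isZero_singularCohomology_three_of_hasHandleDecomposition`, Hatcher Thm. 3.2);
* `isZero_relativeSingularHomology_two_boundary_of_hasHandleDecomposition` —
  `H₂(V, ∂V; ℤ) = 0` by Poincaré–Lefschetz duality `H³(V) ≅ H₂(V, ∂V)` (Hatcher Thm. 3.43, the
  tree's `bijective_relCapProduct_of_isRelFundamentalClass_holds`, with the relative fundamental
  class built exactly as in `isotropic_range_map_boundary_of_hasHandleDecomposition_holds`);
* `epi_map_boundary_two_of_hasHandleDecomposition` — **`H₂(∂V; ℤ) → H₂(V; ℤ)` is onto**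
  (exact sequence of the pair, Hatcher Thm. 2.16).

A `ℤ`-orientation `β` of `∂V` is taken as an argument (it exists whenever `∂V` is simply
connected, the case of Wall's proof). Everything is proved; no definition and no named fact is
introduced.

## References

* C. T. C. Wall, *On simply-connected 4-manifolds*, J. London Math. Soc. 39 (1964) 141–149, §2
  pp. 144–146. [WallJLMS1964]
* J. Milnor, *Lectures on the h-cobordism theorem*, Princeton (1965), Cor. 3.15 and Remark,
  Thm. 7.4. [MilnorHCobordism1965]
* A. Hatcher, *Algebraic Topology*, CUP (2002), Thm. 2.16, §3.1 Thm. 3.2, §3.3 Thm. 3.43.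
  [HatcherAT2002]
-/

noncomputable section

open scoped Manifold ContDiff Topology
open Set Function Module CategoryTheory CategoryTheory.Limits
open Literature.AlgebraicTopology.SingularHomology

namespace Literature.Topology.FourManifolds

universe u

/-! ### Morse homology along Milnor's filtration: `H₃ = 0` without critical points of index `3` -/

namespace Cobordism

variable {n : ℕ} {M N : Type u} [TopologicalSpace M] [T2Space M] [SecondCountableTopology M]
  [ChartedSpace (EuclideanSpace ℝ (Fin n)) M] [IsManifold (𝓡 n) ∞ M] [CompactSpace M]
  [TopologicalSpace N] [T2Space N] [SecondCountableTopology N]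
  [ChartedSpace (EuclideanSpace ℝ (Fin n)) N] [IsManifold (𝓡 n) ∞ N] [CompactSpace N]
  {c : Cobordism n M N} {g : c.W → ℝ}

/-- **`H₃(W_m, V) = 0` along Milnor's filtration** `V = W_{-1} ⊆ W_0 ⊆ ⋯ ⊆ W_{n+1} = W` of a
nice Morse function without critical points of index `3`: by induction on `m` from the exact
sequences `H₃(W_{m-1}, V) → H₃(W_m, V) → H₃(W_m, W_{m-1})` of the triples (Hatcher 2002, p. 118),
the steps having `H₃(W_m, W_{m-1}) = 0` (Milnor 1965, Cor. 3.15: free, concentrated in degree `m`,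
of rank the number of critical points of index `m` — zero for `m = 3`).
[cite: MilnorHCobordism1965, Cor. 3.15 and Remark after Thm. 3.14 (PDF pp. 19–21)]
[cite: HatcherAT2002, §2.1 p. 118 (exact sequence of a triple)] -/
theorem IsNiceMorseFunction.isZero_three (hg : c.IsNiceMorseFunction g)
    (h3 : (criticalSetOfIndex (𝓡∂ (n + 1)) g 3).ncard = 0) :
    ∀ m ≤ n + 2, IsZero (sublevelHomology g (cutLevel n 0) (cutLevel n m) 3) := by
  intro m
  induction m with
  | zero =>
    intro _
    exact isZero_sublevelHomology_self g _ 3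
  | succ m ih =>
    intro hm
    have ih3 := ih ((Nat.le_succ m).trans hm)
    have hab : cutLevel n 0 ≤ cutLevel n m := cutLevel_mono n (Nat.zero_le m)
    have hbt : cutLevel n m ≤ cutLevel n (m + 1) := cutLevel_mono n (Nat.le_succ m)
    have hs3 : IsZero (c.morseHomology g m 3) := by
      by_cases hm3 : m = 3
      · subst hm3; exact hg.isZero_morseHomology_of_ncard_eq_zero h3 3
      · exact hg.isZero_morseHomology_of_ne (Ne.symm hm3)
    exact (sublevel_exact₂ g hab hbt 3).isZero_of_both_zeros (ih3.eq_of_src _ _)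
      (hs3.eq_of_tgt _ _)

end Cobordism

/-! ### The handlebody `V ∈ ℋ(5, k, 2)`: `H₃(V; ℤ) = 0`, `H³(V; ℤ) = 0`, `H₂(V, ∂V; ℤ) = 0` -/

section Handlebody

variable (V : Type) [TopologicalSpace V] [T2Space V] [SecondCountableTopology V]
  [ChartedSpace (EuclideanHalfSpace (4 + 1)) V] [IsManifold (𝓡∂ (4 + 1)) ∞ V] [CompactSpace V]

/-- **`H₃(V; ℤ) = 0` for a handlebody `V ∈ ℋ(5, k, 2)`** (Milnor 1965, §3 and Thm. 7.4: no
critical point of index `3`), from the filtration of a nice Morse function on `(V; ∅, ∂V)`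
(`Cobordism.IsNiceMorseFunction.isZero_three`) and `H⁎(V, ∅) = H⁎(V)`.
[cite: MilnorHCobordism1965, Cor. 3.15 and Remark (PDF pp. 19–21), Thm. 7.4 (PDF p. 48)] -/
theorem isZero_singularHomology_three_of_hasHandleDecomposition {k : ℕ}
    (hV : HasHandleDecomposition 4 V (twoHandlebodyCount k)) :
    IsZero (singularHomology ℤ ℤ V 3) := by
  haveI : CompactSpace ((𝓡∂ (4 + 1)).boundary V) := compactSpace_boundary 4 V
  obtain ⟨g, hg, hcount⟩ := exists_isNiceMorseFunction_of_hasHandleDecomposition V hV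
  have h3 : (criticalSetOfIndex (𝓡∂ (4 + 1)) g 3).ncard = 0 :=
    (hcount 3).trans (twoHandlebodyCount_of_ne (by norm_num) (by norm_num))
  have hZ3 : IsZero (sublevelHomology g (Cobordism.cutLevel 4 0) (Cobordism.cutLevel 4 (4 + 2)) 3) :=
    hg.isZero_three h3 (4 + 2) le_rfl
  -- `W_5 = V` and `W_{-1} = ∅`
  have htop : ∀ z : V, g z ≤ Cobordism.cutLevel 4 (4 + 2) := fun z => by
    rw [Cobordism.cutLevel_eq_one]; exact (hg.isMorseFunction.mem_Icc z).2
  have hset : {z : V | g z ≤ Cobordism.cutLevel 4 0} = range (Cobordism.ofBoundary 4 V).inl :=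
    hg.isMorseFunction.setOf_le_cutLevel_zero
  haveI hE : IsEmpty ↥({z : V | g z ≤ Cobordism.cutLevel 4 0}) :=
    ⟨fun z => by
      have hz : (z : V) ∈ range (Cobordism.ofBoundary 4 V).inl := hset ▸ z.2
      obtain ⟨x, -⟩ := hz
      exact PEmpty.elim x⟩
  haveI := relativeSingularHomology.isIso_ofAbsolute_of_isEmpty ℤ ℤ
    ({z : V | g z ≤ Cobordism.cutLevel 4 0}) 3
  have e : singularHomology ℤ ℤ V 3 ≅
      sublevelHomology g (Cobordism.cutLevel 4 0) (Cobordism.cutLevel 4 (4 + 2)) 3 :=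
    asIso (relativeSingularHomology.ofAbsolute ℤ ℤ V {z : V | g z ≤ Cobordism.cutLevel 4 0} 3)
      ≪≫ (sublevelHomologyTopIso g (Cobordism.cutLevel 4 0) htop 3).symm
  exact hZ3.of_iso e

/-- **`H₂(V; ℤ)` is free** for a handlebody `V ∈ ℋ(5, k, 2)`: finitely generated and torsion-free
(`isZero_four_isTorsionFree_two_of_hasHandleDecomposition`), over the PID `ℤ`.
[cite: MilnorHCobordism1965, Thm. 7.4 (PDF p. 48)] -/
theorem free_singularHomology_two_of_hasHandleDecomposition {k : ℕ}
    (hV : HasHandleDecomposition 4 V (twoHandlebodyCount k)) :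
    Module.Free ℤ (singularHomology ℤ ℤ V 2) := by
  obtain ⟨-, htf, hfin⟩ := isZero_four_isTorsionFree_two_of_hasHandleDecomposition V hV
  haveI := htf
  haveI := hfin
  exact Module.free_of_finite_type_torsion_free'

/-- **`H³(V; ℤ) = 0`** for a handlebody `V ∈ ℋ(5, k, 2)`: universal coefficients with vanishing
`Ext` term (`H₂(V; ℤ)` free): `H³(V; ℤ) ≅ Hom(H₃(V; ℤ), ℤ) = Hom(0, ℤ) = 0` (Hatcher 2002, Thm. 3.2;
the tree's `kroneckerPairing_bijective_of_free`). [cite: HatcherAT2002, §3.1 Thm. 3.2 (p. 195)] -/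
theorem isZero_singularCohomology_three_of_hasHandleDecomposition {k : ℕ}
    (hV : HasHandleDecomposition 4 V (twoHandlebodyCount k)) :
    IsZero (singularCohomology ℤ ℤ V 3) := by
  haveI := free_singularHomology_two_of_hasHandleDecomposition V hV
  have h3 := isZero_singularHomology_three_of_hasHandleDecomposition V hV
  have hκ := kroneckerPairing_bijective_of_free ℤ V 2
  haveI : Subsingleton (singularHomology ℤ ℤ V 3) := ModuleCat.subsingleton_of_isZero h3
  haveI : Subsingleton (singularHomology ℤ ℤ V 3 →ₗ[ℤ] ℤ) :=
    ⟨fun f g => LinearMap.ext fun x => by rw [Subsingleton.elim x 0, map_zero, map_zero]⟩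
  haveI : Subsingleton (singularCohomology ℤ ℤ V 3) := hκ.1.subsingleton
  exact ModuleCat.isZero_of_subsingleton _

/-- **`H₂(V, ∂V; ℤ) = 0`** for a handlebody `V ∈ ℋ(5, k, 2)` with `∂V` `ℤ`-oriented by `β`:
Poincaré–Lefschetz duality `· ⌢ w : H³(V; ℤ) ≅ H₂(V, ∂V; ℤ)` (Hatcher 2002, Thm. 3.43; the tree's
`bijective_relCapProduct_of_isRelFundamentalClass_holds`) for a relative fundamental class `w` with
`∂w = [∂V]_β` (which exists because `H₄(V) = 0` makes `∂` onto, and every component of `V` meets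
`∂V` — exactly as in `isotropic_range_map_boundary_of_hasHandleDecomposition_holds`), and
`H³(V; ℤ) = 0`. [cite: HatcherAT2002, §3.3 Thm. 3.43] -/
theorem isZero_relativeSingularHomology_two_boundary_of_hasHandleDecomposition {k : ℕ}
    (hV : HasHandleDecomposition 4 V (twoHandlebodyCount k))
    (β : HomologicalOrientation ℤ ((𝓡∂ (4 + 1)).boundary V) 4) :
    IsZero (relativeSingularHomology ℤ ℤ V ((𝓡∂ (4 + 1)).boundary V) 2) := by
  haveI : CompactSpace ((𝓡∂ (4 + 1)).boundary V) := compactSpace_boundary 4 V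
  have hH3 := isZero_singularCohomology_three_of_hasHandleDecomposition V hV
  obtain ⟨h4, -, -⟩ := isZero_four_isTorsionFree_two_of_hasHandleDecomposition V hV
  obtain ⟨f, hf, hcount⟩ := hV
  have h5 : criticalSetOfIndex (𝓡∂ (4 + 1)) f (4 + 1) = ∅ := by
    have hfin5 : (criticalSetOfIndex (𝓡∂ (4 + 1)) f (4 + 1)).Finite :=
      (IsMorse.finite_criticalSet_holds hf.isMorse).subset (criticalSetOfIndex_subset _ _ _)
    exact (Set.ncard_eq_zero hfin5).1
      ((hcount (4 + 1)).trans (twoHandlebodyCount_of_ne (by norm_num) (by norm_num)))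
  have hcomp : ∀ x : V, ∃ y ∈ (𝓡∂ (4 + 1)).boundary V, y ∈ connectedComponent x :=
    exists_mem_boundary_mem_connectedComponent_of_isMorseAdapted V hf h5
  -- the fundamental class of `∂V`, and a relative fundamental class `w` with `∂w = [∂V]`
  have hfc : IsFundamentalClass β β.fundamentalClass :=
    HomologicalOrientation.isFundamentalClass_fundamentalClass_holds (R := ℤ)
      (X := ↥((𝓡∂ (4 + 1)).boundary V)) 4 β
  have hepi : Epi (relativeSingularHomology.δ ℤ ℤ V ((𝓡∂ (4 + 1)).boundary V) 4) :=
    (relativeSingularHomology.exact_δ_map ℤ ℤ ((𝓡∂ (4 + 1)).boundary V) 4).epi_f (h4.eq_of_tgt _ _)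
  obtain ⟨w, hw⟩ := (ModuleCat.epi_iff_surjective _).1 hepi β.fundamentalClass
  have hw' : (relativeSingularHomology.δ ℤ ℤ V ((𝓡∂ (4 + 1)).boundary V) 4) w = β.fundamentalClass :=
    hw
  have hinf : (∞ : WithTop ℕ∞) ≠ 0 := by simp
  have hwf : IsRelFundamentalClass ℤ ((𝓡∂ (4 + 1)).boundary V) w := by
    refine isRelFundamentalClass_of_isGenerator_toLocal_δ_of_isManifold (R := ℤ) hinf four_ne_zero w
      (fun y => ?_) hcomp
    obtain ⟨e, he⟩ := β.isGenerator y
    refine ⟨e, ?_⟩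
    rw [hw', hfc y, he]
  -- Lefschetz duality in bidegree `(3, 2)`
  have hL := bijective_relCapProduct_of_isRelFundamentalClass_holds (R := ℤ) 4 V w hwf
    (show 3 + 2 = 4 + 1 from rfl)
  unfold bijective_relCapProduct_of_isRelFundamentalClass at hL
  haveI : Subsingleton (singularCohomology ℤ ℤ V 3) := ModuleCat.subsingleton_of_isZero hH3
  haveI : Subsingleton (relativeSingularHomology ℤ ℤ V ((𝓡∂ (4 + 1)).boundary V) 2) :=
    hL.2.subsingleton
  exact ModuleCat.isZero_of_subsingleton _

/-- **`H₂(∂V; ℤ) → H₂(V; ℤ)` is onto for a handlebody `V ∈ ℋ(5, k, 2)`** (with `∂V`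
`ℤ`-orientable): exact sequence of the pair `H₂(∂V) → H₂(V) → H₂(V, ∂V) = 0` (Hatcher 2002,
Thm. 2.16). This is the input "`H₂(∂V) → H₂(V)` onto" of Wall's computation of `H₂(R)` (1964,
p. 146) in the form consumed by `CobordismAttachment.epi_map_jX_of_epi`.
[cite: WallJLMS1964, §2 p. 146] [cite: HatcherAT2002, Thm. 2.16] -/
theorem epi_map_boundary_two_of_hasHandleDecomposition {k : ℕ}
    (hV : HasHandleDecomposition 4 V (twoHandlebodyCount k))
    (β : HomologicalOrientation ℤ ((𝓡∂ (4 + 1)).boundary V) 4) :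
    Epi (singularHomology.map ℤ ℤ
      (⟨Subtype.val, continuous_subtype_val⟩ : C(↥((𝓡∂ (4 + 1)).boundary V), V)) 2) :=
  (relativeSingularHomology.exact_map_ofAbsolute ℤ ℤ ((𝓡∂ (4 + 1)).boundary V) 2).epi_f
    ((isZero_relativeSingularHomology_two_boundary_of_hasHandleDecomposition V hV β).eq_of_tgt _ _)

end Handlebody

end Literature.Topology.FourManifolds

end
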